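import Summits.ResolutionOfSingularities.ResolutionOfSingularities.Theorems.EquisingularLiftEquisingularLiftNatCompanionModelChart2
import HarnessLib

/-!
# [OURS · L1 W4.5(b) · EL♮] K-COMP-LOCAL (chart `w = x₁y₁ − ϖ`): the strict transform of `Y : x₁x₂ + x₃² = 0` under the
# `m = 1` COMPANION touch is an affine `4`-space on the chart `w ≠ 0`; all three charts are regular
# (crux `EquisingularLiftNat` = stmt-ResolutionOfSingularities-20038; K-∀n / K5-BMY lane, kill test #50)

HONEST FRAMING. OURS (cell res-hironaka, crux chain w45b, slot W4.5(b)); NOT a statement of any manuscript; replaces the role of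
NOTHING in the manuscript; AI-written, AI review is weaker than expert review. Helper `--supports stmt-ResolutionOfSingularities-20038
--as helper`. Sequel of `…NatCompanionModelChart3` (p543728, chart `x₃`) and `…NatCompanionModelChart2` (chart `x₂`); object
K-COMP-LOCAL of res-L1-w45b-strat-1's STRATEGY-CENSUS v10 (sha16 0ed0c3dd766d6f34) §4 (N5.2) / §5 R2″.

THE THEOREM (N5.2 «chart `w` (`x₂ = we`, `x₃ = wf`): … regular»), sorry-free: on `Y` one has `w̄ = x̄₁ȳ₁` (`ϖ = 0`), and the
evaluation `ψ_w : k[x₁, y₁, y₂, f] → B_w := 𝒪_Y[(x̄₂, x̄₃, x̄₁ȳ₁)/x̄₁ȳ₁]`, `f ↦ x̄₃/x̄₁ȳ₁`, is a BIJECTION for `k` a domain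
(`ψw_bijective`); the relation `e := x̄₂/x̄₁ȳ₁ = −ȳ₁·f²` holds (`frac_zero_eqw`); for a field the chart is a regular ring
(`isRegularRing_Bw`), and **all three charts of the blow-up of `Y` along the trace `(x̄₂, x̄₃, x̄₁ȳ₁)` are regular**
(`isRegularRing_chart`): the strict transform of `Y` under the companion touch is regular over `S ∪ D ∪ T` in N5.2's model.
Proof as for the other charts; left inverse `Λ_w : 𝒪_Y[1/x̄₁ȳ₁] → k[x₁,y₁,y₂,f][1/(x₁y₁)]`, `x₂ ↦ −x₁y₁²f²`, `x₃ ↦ x₁y₁f`.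
Model coordinates `X 0, …, X 3 = x₁, y₁, y₂, f`.

References: res-L1-w45b-strat-1 STRATEGY-CENSUS v10 N5.2; [StacksProject, Tags 052P/052Q/080E]; [GortzWedhorn2020, (13.19) p. 415].
-/

set_option linter.dupNamespace false -- mandated namespace `Summit.<Summit>.<Problem>` of this single-conjunct summit

noncomputable section

universe u

open Literature.AlgebraicGeometry.Resolution MvPolynomial

namespace Summit.ResolutionOfSingularities.ResolutionOfSingularities.Cruxes.EquisingularLiftNat.Sections

namespace CompanionModel

variable (k : Type u) [CommRing k]

/-! # Chart `w` (`a = w̄ = x̄₁ȳ₁`): `B_w = 𝒪_Y[(x̄₂,x̄₃,x̄₁ȳ₁)/x̄₁ȳ₁] ≅ k[x₁, y₁, y₂, f]`, `f ↦ x̄₃/x̄₁ȳ₁`, with `x̄₂/x̄₁ȳ₁ = −ȳ₁f²` -/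

/-- `a₁b₁ε = 1`, `a₃² = −a₁a₂` ⇒ `a₂ε = −b₁(a₃ε)²`. [folklore] -/
theorem relw_frac {L : Type*} [CommRing L] (a₁ a₂ a₃ b₁ e : L) (he : a₁ * b₁ * e = 1) (hg : a₃ ^ 2 = -(a₁ * a₂)) :
    a₂ * e = -(b₁ * (a₃ * e) ^ 2) := by
  symm
  calc -(b₁ * (a₃ * e) ^ 2) = -(b₁ * a₃ ^ 2 * e ^ 2) := by ring
    _ = -(b₁ * (-(a₁ * a₂)) * e ^ 2) := by rw [hg]
    _ = a₂ * e * (a₁ * b₁ * e) := by ring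
    _ = a₂ * e := by rw [he, mul_one]

/-- The chart `B_w = 𝒪_Y[(x̄₂, x̄₃, x̄₁ȳ₁)/x̄₁ȳ₁] ⊆ 𝒪_Y[1/x̄₁ȳ₁]`. OURS bookkeeping. -/
abbrev Bw : Subalgebra (OY k) (Localization.Away (tr k 2)) := blowupAlgebra (Ideal.span (Set.range (tr k))) (tr k 2)

/-- The values of the model coordinates `x₁, y₁, y₂, f` in `B_w`: `x̄₁`, `ȳ₁`, `ȳ₂`, `x̄₃/x̄₁ȳ₁`. OURS bookkeeping. -/
def cvw : Fin 4 → Bw k :=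
  ![algebraMap (OY k) (Bw k) (mkY k (X 0)), algebraMap (OY k) (Bw k) (mkY k (X 3)), algebraMap (OY k) (Bw k) (mkY k (X 4)),
    blowupAlgebra.frac (tr k) 2 1]

/-- **`ψ_w : k[x₁, y₁, y₂, f] → B_w`**, `f ↦ x̄₃/x̄₁ȳ₁` (model coordinates `X 0, …, X 3 = x₁, y₁, y₂, f`). OURS bookkeeping. -/
def ψw : MvPolynomial (Fin 4) k →+* Bw k :=
  MvPolynomial.eval₂Hom ((algebraMap (OY k) (Bw k)).comp ((mkY k).comp MvPolynomial.C)) (cvw k)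

/-- `w̄ · (1/w̄) = 1` in `𝒪_Y[1/w̄]`. [folklore] -/
theorem w_mul_invSelf :
    algebraMap (OY k) (Localization.Away (tr k 2)) (tr k 2) * IsLocalization.Away.invSelf (tr k 2) = 1 :=
  IsLocalization.Away.mul_invSelf (S := Localization.Away (tr k 2)) (tr k 2)

/-- `x̄₁ · ȳ₁ · (1/w̄) = 1` in `𝒪_Y[1/w̄]`. [folklore] -/
theorem x₁_mul_y₁_mul_invSelf :
    algebraMap (OY k) (Localization.Away (tr k 2)) (mkY k (X 0)) * algebraMap (OY k) (Localization.Away (tr k 2)) (mkY k (X 3)) *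
      IsLocalization.Away.invSelf (tr k 2) = 1 := by
  rw [← map_mul, ← map_mul]
  exact w_mul_invSelf k

/-- `x̄₃² = −x̄₁x̄₂` in `𝒪_Y[1/w̄]`. [folklore] -/
theorem sq_x₃_eq_locw :
    algebraMap (OY k) (Localization.Away (tr k 2)) (mkY k (X 2)) ^ 2 =
      -(algebraMap (OY k) (Localization.Away (tr k 2)) (mkY k (X 0)) *
        algebraMap (OY k) (Localization.Away (tr k 2)) (mkY k (X 1))) := by
  rw [← map_pow, sq_x₃_eq, map_neg, map_mul]

/-- `ψ_w` on constants. [folklore] -/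
theorem ψw_C (a : k) : ψw k (C a) = algebraMap (OY k) (Bw k) (mkY k (C a)) := MvPolynomial.eval₂Hom_C _ _ a

/-- `ψ_w x₁ = x̄₁`. [folklore] -/
theorem ψw_X₀ : ψw k (X 0) = algebraMap (OY k) (Bw k) (mkY k (X 0)) := MvPolynomial.eval₂Hom_X' _ _ 0

/-- `ψ_w y₁ = ȳ₁`. [folklore] -/
theorem ψw_X₁ : ψw k (X 1) = algebraMap (OY k) (Bw k) (mkY k (X 3)) := MvPolynomial.eval₂Hom_X' _ _ 1

/-- `ψ_w y₂ = ȳ₂`. [folklore] -/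
theorem ψw_X₂ : ψw k (X 2) = algebraMap (OY k) (Bw k) (mkY k (X 4)) := MvPolynomial.eval₂Hom_X' _ _ 2

/-- `ψ_w f = x̄₃/w̄`. [folklore] -/
theorem ψw_X₃ : ψw k (X 3) = blowupAlgebra.frac (tr k) 2 1 := MvPolynomial.eval₂Hom_X' _ _ 3

/-- **N5.2 chart `w`, the relation: `e := x̄₂/w̄ = −ȳ₁·f²` in `B_w`.** [folklore] -/
theorem frac_zero_eqw : blowupAlgebra.frac (tr k) 2 0 = -(ψw k (X 1) * ψw k (X 3) ^ 2) := by
  rw [ψw_X₁, ψw_X₃]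
  apply Subtype.ext
  rw [blowupAlgebra.coe_frac, Subalgebra.coe_neg, Subalgebra.coe_mul, Subalgebra.coe_pow, blowupAlgebra.coe_frac]
  change algebraMap (OY k) (Localization.Away (tr k 2)) (mkY k (X 1)) * IsLocalization.Away.invSelf (tr k 2) =
    -(algebraMap (OY k) (Localization.Away (tr k 2)) (mkY k (X 3)) *
      (algebraMap (OY k) (Localization.Away (tr k 2)) (mkY k (X 2)) * IsLocalization.Away.invSelf (tr k 2)) ^ 2)
  exact relw_frac _ _ _ _ _ (x₁_mul_y₁_mul_invSelf k) (sq_x₃_eq_locw k)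

/-- `x̄₃ = x̄₁ · ȳ₁ · f` in `B_w`. [folklore] -/
theorem algebraMap_x₃_eqw : algebraMap (OY k) (Bw k) (mkY k (X 2)) = ψw k (X 0) * ψw k (X 1) * ψw k (X 3) := by
  rw [ψw_X₀, ψw_X₁, ψw_X₃, ← map_mul, ← map_mul]
  apply Subtype.ext
  rw [Subalgebra.coe_mul, blowupAlgebra.coe_frac]
  exact rel_x₂ _ _ _ (w_mul_invSelf k)

/-- `x̄₂ = x̄₁ · ȳ₁ · e = −x̄₁ȳ₁·ȳ₁f²` in `B_w`. [folklore] -/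
theorem algebraMap_x₂_eqw :
    algebraMap (OY k) (Bw k) (mkY k (X 1)) = ψw k (X 0) * ψw k (X 1) * -(ψw k (X 1) * ψw k (X 3) ^ 2) := by
  rw [← frac_zero_eqw, ψw_X₀, ψw_X₁, ← map_mul, ← map_mul]
  apply Subtype.ext
  rw [Subalgebra.coe_mul, blowupAlgebra.coe_frac]
  exact rel_x₂ _ _ _ (w_mul_invSelf k)

/-- Every `x̄ⱼ` lies in the image of `ψ_w`. [folklore] -/
theorem algebraMap_X_mem_rangew (j : Fin 5) : algebraMap (OY k) (Bw k) (mkY k (X j)) ∈ (ψw k).range := by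
  match j with
  | ⟨0, _⟩ => exact ⟨X 0, ψw_X₀ k⟩
  | ⟨1, _⟩ =>
    exact (show algebraMap (OY k) (Bw k) (mkY k (X 1)) ∈ (ψw k).range from
      ⟨X 0 * X 1 * -(X 1 * X 3 ^ 2), by rw [map_mul, map_mul, map_neg, map_mul, map_pow, ← algebraMap_x₂_eqw]⟩)
  | ⟨2, _⟩ =>
    exact (show algebraMap (OY k) (Bw k) (mkY k (X 2)) ∈ (ψw k).range from
      ⟨X 0 * X 1 * X 3, by rw [map_mul, map_mul, ← algebraMap_x₃_eqw]⟩)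
  | ⟨3, _⟩ => exact ⟨X 1, ψw_X₁ k⟩
  | ⟨4, _⟩ => exact ⟨X 2, ψw_X₂ k⟩

/-- Every constant lies in the image of `ψ_w`. [folklore] -/
theorem algebraMap_mem_rangew (y : OY k) : algebraMap (OY k) (Bw k) y ∈ (ψw k).range := by
  obtain ⟨G, rfl⟩ := Ideal.Quotient.mk_surjective y
  induction G using MvPolynomial.induction_on with
  | C a => exact ⟨C a, ψw_C k a⟩
  | add p q hp hq => rw [map_add, map_add]; exact add_mem hp hq
  | mul_X p j hp => rw [map_mul, map_mul]; exact mul_mem hp (algebraMap_X_mem_rangew k j)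

/-- Every fraction `x/w̄` lies in the image of `ψ_w`. [folklore] -/
theorem frac_mem_rangew (j : Fin 3) : blowupAlgebra.frac (tr k) 2 j ∈ (ψw k).range := by
  have h2 : blowupAlgebra.frac (tr k) 2 2 ∈ (ψw k).range := by
    refine ⟨1, ?_⟩
    rw [map_one]
    apply Subtype.ext
    rw [blowupAlgebra.coe_frac, OneMemClass.coe_one]
    exact (w_mul_invSelf k).symm
  match j with
  | ⟨0, _⟩ =>
    exact (show blowupAlgebra.frac (tr k) 2 0 ∈ (ψw k).range from
      ⟨-(X 1 * X 3 ^ 2), by rw [map_neg, map_mul, map_pow, ← frac_zero_eqw]⟩)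
  | ⟨1, _⟩ => exact ⟨X 3, ψw_X₃ k⟩
  | ⟨2, _⟩ => exact h2

/-- **`ψ_w` is onto.** [folklore] -/
theorem ψw_surjective : Function.Surjective (ψw k) := by
  intro z
  obtain ⟨F, rfl⟩ := blowupAlgebra.eval_surjective (tr k) 2 z
  suffices h : (blowupAlgebra.eval (tr k) 2 F) ∈ (ψw k).range by exact h
  induction F using MvPolynomial.induction_on with
  | C y => rw [blowupAlgebra.eval_C]; exact algebraMap_mem_rangew k y
  | add p q hp hq => rw [map_add]; exact add_mem hp hq
  | mul_X p j hp => rw [map_mul, blowupAlgebra.eval_X]; exact mul_mem hp (frac_mem_rangew k j.1)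

/-- The inverse substitution `x₁ ↦ x₁, x₂ ↦ −x₁y₁²f², x₃ ↦ x₁y₁f, y₁ ↦ y₁, y₂ ↦ y₂`. OURS bookkeeping. -/
def lamValw : Fin 5 → MvPolynomial (Fin 4) k := ![X 0, -(X 0 * X 1 ^ 2 * X 3 ^ 2), X 0 * X 1 * X 3, X 1, X 2]

/-- `x₁ ↦ x₁`. [folklore] -/
theorem lamValw_zero : lamValw k 0 = X 0 := rfl

/-- `x₂ ↦ −x₁y₁²f²`. [folklore] -/
theorem lamValw_one : lamValw k 1 = -(X 0 * X 1 ^ 2 * X 3 ^ 2) := rfl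

/-- `x₃ ↦ x₁y₁f`. [folklore] -/
theorem lamValw_two : lamValw k 2 = X 0 * X 1 * X 3 := rfl

/-- `y₁ ↦ y₁`. [folklore] -/
theorem lamValw_three : lamValw k 3 = X 1 := rfl

/-- `y₂ ↦ y₂`. [folklore] -/
theorem lamValw_four : lamValw k 4 = X 2 := rfl

/-- The substitution kills `g`. [folklore] -/
theorem subst_gYw : MvPolynomial.eval₂Hom MvPolynomial.C (lamValw k) (gY k) = 0 := by
  simp only [gY, map_add, map_mul, map_pow, MvPolynomial.eval₂Hom_X', lamValw_zero, lamValw_one, lamValw_two]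
  ring

/-- `λ_w : 𝒪_Y → k[x₁,y₁,y₂,f][1/(x₁y₁)]`. OURS bookkeeping. -/
def lamw : OY k →+* Localization.Away (X 0 * X 1 : MvPolynomial (Fin 4) k) :=
  Ideal.Quotient.lift (Ideal.span {gY k})
    ((algebraMap (MvPolynomial (Fin 4) k) (Localization.Away (X 0 * X 1 : MvPolynomial (Fin 4) k))).comp
      (MvPolynomial.eval₂Hom MvPolynomial.C (lamValw k)))
    (fun a ha => by
      obtain ⟨b, rfl⟩ := Ideal.mem_span_singleton'.mp ha
      rw [RingHom.comp_apply, map_mul, subst_gYw, mul_zero, map_zero])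

/-- `λ_w` on classes. [folklore] -/
theorem lamw_mkY (F : MvPolynomial (Fin 5) k) :
    lamw k (mkY k F) = algebraMap (MvPolynomial (Fin 4) k) (Localization.Away (X 0 * X 1 : MvPolynomial (Fin 4) k))
      (MvPolynomial.eval₂Hom MvPolynomial.C (lamValw k) F) :=
  Ideal.Quotient.lift_mk _ _ _

/-- `λ_w(w̄) = x₁y₁`. [folklore] -/
theorem lamw_tr_two : lamw k (tr k 2) =
    algebraMap (MvPolynomial (Fin 4) k) (Localization.Away (X 0 * X 1 : MvPolynomial (Fin 4) k)) (X 0 * X 1) := by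
  change lamw k (mkY k (X 0 * X 3)) = _
  rw [lamw_mkY, map_mul, MvPolynomial.eval₂Hom_X', MvPolynomial.eval₂Hom_X', lamValw_zero, lamValw_three]

/-- `λ_w(w̄)` is a unit. [folklore] -/
theorem isUnit_lamw_tr_two : IsUnit (lamw k (tr k 2)) := by
  rw [lamw_tr_two]
  exact IsLocalization.Away.algebraMap_isUnit (X 0 * X 1 : MvPolynomial (Fin 4) k)

/-- **`Λ_w : 𝒪_Y[1/w̄] → k[x₁,y₁,y₂,f][1/(x₁y₁)]`**, the left inverse of `ψ_w` after localisation. OURS bookkeeping. -/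
def Λw : Localization.Away (tr k 2) →+* Localization.Away (X 0 * X 1 : MvPolynomial (Fin 4) k) :=
  IsLocalization.Away.lift (tr k 2) (isUnit_lamw_tr_two k)

/-- `Λ_w` extends `λ_w`. [folklore] -/
theorem Λw_algebraMap (y : OY k) : Λw k (algebraMap (OY k) (Localization.Away (tr k 2)) y) = lamw k y :=
  IsLocalization.Away.lift_eq (tr k 2) (isUnit_lamw_tr_two k) y

/-- `Λ_w` on a fraction `r/w̄`: if `λ_w r = t · λ_w w̄` then `Λ_w (r/w̄) = t`. [folklore] -/
theorem Λw_frac {r : OY k} {t : Localization.Away (X 0 * X 1 : MvPolynomial (Fin 4) k)} (h : lamw k r = t * lamw k (tr k 2)) :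
    Λw k (algebraMap (OY k) (Localization.Away (tr k 2)) r * IsLocalization.Away.invSelf (tr k 2)) = t := by
  refine (isUnit_lamw_tr_two k).mul_left_injective ?_
  dsimp only
  rw [← h, ← Λw_algebraMap k (tr k 2), ← map_mul, mul_assoc, mul_comm (IsLocalization.Away.invSelf (tr k 2)),
    w_mul_invSelf, mul_one, Λw_algebraMap]

/-- **`Λ_w ∘ ψ_w = (k[x₁,y₁,y₂,f] → k[x₁,y₁,y₂,f][1/(x₁y₁)])`.** [folklore] -/
theorem Λw_comp_ψw :
    (Λw k).comp (((Bw k).val : Bw k →+* Localization.Away (tr k 2)).comp (ψw k)) =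
      algebraMap (MvPolynomial (Fin 4) k) (Localization.Away (X 0 * X 1 : MvPolynomial (Fin 4) k)) := by
  refine MvPolynomial.ringHom_ext (fun a => ?_) (fun j => ?_)
  · rw [RingHom.comp_apply, RingHom.comp_apply, ψw_C]
    change Λw k (algebraMap (OY k) (Localization.Away (tr k 2)) (mkY k (C a))) = _
    rw [Λw_algebraMap, lamw_mkY, MvPolynomial.eval₂Hom_C]
  · rw [RingHom.comp_apply, RingHom.comp_apply]
    match j with
    | ⟨0, _⟩ =>
      change Λw k ((ψw k (X 0) : Bw k) : Localization.Away (tr k 2)) = algebraMap _ _ (X 0)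
      rw [ψw_X₀]
      change Λw k (algebraMap (OY k) (Localization.Away (tr k 2)) (mkY k (X 0))) = _
      rw [Λw_algebraMap, lamw_mkY, MvPolynomial.eval₂Hom_X']
      rfl
    | ⟨1, _⟩ =>
      change Λw k ((ψw k (X 1) : Bw k) : Localization.Away (tr k 2)) = algebraMap _ _ (X 1)
      rw [ψw_X₁]
      change Λw k (algebraMap (OY k) (Localization.Away (tr k 2)) (mkY k (X 3))) = _
      rw [Λw_algebraMap, lamw_mkY, MvPolynomial.eval₂Hom_X']
      rfl
    | ⟨2, _⟩ =>
      change Λw k ((ψw k (X 2) : Bw k) : Localization.Away (tr k 2)) = algebraMap _ _ (X 2)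
      rw [ψw_X₂]
      change Λw k (algebraMap (OY k) (Localization.Away (tr k 2)) (mkY k (X 4))) = _
      rw [Λw_algebraMap, lamw_mkY, MvPolynomial.eval₂Hom_X']
      rfl
    | ⟨3, _⟩ =>
      change Λw k ((ψw k (X 3) : Bw k) : Localization.Away (tr k 2)) = algebraMap _ _ (X 3)
      rw [ψw_X₃, blowupAlgebra.coe_frac]
      refine Λw_frac k ?_
      change lamw k (mkY k (X 2)) = _
      rw [lamw_tr_two, lamw_mkY, MvPolynomial.eval₂Hom_X', ← map_mul, lamValw_two]
      congr 1
      ring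

/-- **`ψ_w` is injective** (`k` a domain). [folklore] -/
theorem ψw_injective [IsDomain k] : Function.Injective (ψw k) := by
  have hne : (X 0 * X 1 : MvPolynomial (Fin 4) k) ≠ 0 := mul_ne_zero (MvPolynomial.X_ne_zero 0) (MvPolynomial.X_ne_zero 1)
  have hinj : Function.Injective
      (algebraMap (MvPolynomial (Fin 4) k) (Localization.Away (X 0 * X 1 : MvPolynomial (Fin 4) k))) :=
    IsLocalization.injective _ (powers_le_nonZeroDivisors_of_noZeroDivisors hne)
  rw [← Λw_comp_ψw, RingHom.coe_comp, RingHom.coe_comp] at hinj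
  exact hinj.of_comp.of_comp

/-- **K-COMP-LOCAL, chart `w` (N5.2): `ψ_w : k[x₁, y₁, y₂, f] → B_w` is a bijection**; relation `x̄₂/w̄ = −ȳ₁f²`
(N5.2: «`Ỹ = V(w − x₁y₁, e + …f²)`», with `e = −y₁f²` in these coordinates). OURS. -/
theorem ψw_bijective [IsDomain k] : Function.Bijective (ψw k) :=
  ⟨ψw_injective k, ψw_surjective k⟩

/-- **The chart `B_w` is a regular ring** (over a field). OURS. -/
theorem isRegularRing_Bw (K : Type u) [Field K] : IsRegularRing (Bw K) :=
  IsRegularRing.of_ringEquiv (RingEquiv.ofBijective (ψw K) (ψw_bijective K))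

/-- **K-COMP-LOCAL (N5.2), all three charts: the strict transform of `Y : x₁x₂ + x₃² = 0` under the `m = 1` companion touch —
the blow-up of `Y` along the trace `(x̄₂, x̄₃, x̄₁ȳ₁)` — is REGULAR: every chart `𝒪_Y[(x̄₂,x̄₃,x̄₁ȳ₁)/a]`, `a` a member of the
trace family, is a regular ring (over a field).** OURS. -/
theorem isRegularRing_chart (K : Type u) [Field K] (i : Fin 3) :
    IsRegularRing (blowupAlgebra (Ideal.span (Set.range (tr K))) (tr K i)) := by
  match i with
  | ⟨0, _⟩ => exact isRegularRing_B₂ K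
  | ⟨1, _⟩ => exact isRegularRing_B₃ K
  | ⟨2, _⟩ => exact isRegularRing_Bw K

end CompanionModel

end Summit.ResolutionOfSingularities.ResolutionOfSingularities.Cruxes.EquisingularLiftNat.Sections
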